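import Summits.NavierStokesRegularity.NavierStokesRegularity.Theorems.LerayQuarterDissipationFiniteDissipationLiouvilleFarFieldSlices
import HarnessLib

/-!
# Crux `FiniteDissipationLiouville` (stmt-NavierStokesRegularity-22144): FAR-FIELD REGULARITY THROUGH
# THE SINGULAR TIME for members of the finite-dissipation stratum (file 3/3)

Theorems file of route `LerayQuarterDissipation` (lead prover g4; `--supports` the crux). Navier–Stokes
regularity is NOT proved by anything here; no summit is.

**Main result** (`exists_farField_bound`). Every member `u` of a stratum `𝒟_{C,K}` (Type-I ancient
mild field in the KNSS gauge with Leray's quarter-rate dissipation law) is BOUNDED near the final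
time outside a large ball: there are `R₀` and `M` with `|u(t, x)| ≤ M` for `t ∈ (−1/16, 0)`,
`|x| ≥ R₀`. With the finite singular set (`…FiniteSingularSet.lean`) this confines Type-I
dissipation-law blow-up to finitely many points, uniformly up to the singular time and out to
spatial infinity (`exists_bound_off_singularSet`: bounded near `t = 0` off every neighbourhood of
the finite singular set).

**Proof.** One-scale ε-regularity at the final time (`exists_epsilon_apex`, tree-proved
Lemarié-Rieusset Thm. 14.4) on `Q_{1/2}(0, x₀)`, `|x₀| → ∞`, for the pressure gauged by a local
average AROUND `x₀` (`p₀ − m_{x₀}`, smooth in time, so the pair stays classical): slice by slice the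
CKN quantity on `B(x₀, 1/2)` is controlled by the `L⁶` norm of `u(t)` and the `L³` norm of the Riesz
pressure `Q(t)` on `B̄(x₀, 1/2)` (`…FarFieldTools`, `…FarFieldSlices`), which tend to `0` at spatial infinity; dominated
convergence in time against the Type-I slice rate `(−t)^{−3/4}` (along any sequence `|x_n| → ∞`).
-/

noncomputable section

-- the summit and its single sub-problem share the name (CONVENTIONS §1), as in every Theorems file
set_option linter.dupNamespace false

namespace Summit.NavierStokesRegularity.NavierStokesRegularity.Theorems.FiniteDissipationLiouville.Birth.Apex

open MeasureTheory Set Filter Topology Metric Function TopologicalSpace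
open Literature.Analysis Literature.Analysis.FluidPDE
open scoped ENNReal NNReal

/-! ### Step D1: the CKN quantity with the local gauge tends to zero at spatial infinity -/

/-- **The CKN quantity at the final time, with the local gauge, tends to `0` along every sequence of
centres escaping to infinity** (dominated convergence in time against the Type-I slice rate). -/
theorem tendsto_cknQuantity_localGauge {C : ℝ}
    {u : ℝ → EuclideanSpace ℝ (Fin 3) → EuclideanSpace ℝ (Fin 3)}
    {p₀ : ℝ → EuclideanSpace ℝ (Fin 3) → ℝ} (hu : IsTypeIAncientMild C u)
    (hsol₀ : IsClassicalNSSolutionOn (Iio 0) 1 0 u p₀)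
    (θ : ContDiffBump (0 : EuclideanSpace ℝ (Fin 3))) {BΘ : ℝ} (hBΘ : ∀ y, θ.normed volume y ≤ BΘ)
    {m : EuclideanSpace ℝ (Fin 3) → ℝ → ℝ} (hm_cont : ∀ x₀, ContinuousOn (m x₀) (Iio 0))
    (hm_val : ∀ x₀, ∀ t ∈ Iio (0 : ℝ), m x₀ t = ∫ y, θ.normed volume y * p₀ t (x₀ - y))
    {A Cq : ℝ} (hA : 0 ≤ A) (hCq : 0 ≤ Cq)
    (h6 : ∀ t ∈ Ioo (-1 : ℝ) 0,
      eLpNorm (u t) (ENNReal.ofReal 6) volume ≤ ENNReal.ofReal (A * (-t) ^ (-(1 / 4 : ℝ))))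
    (hdec : ∀ t ∈ Ioo (-1 : ℝ) 0, ∃ Q : EuclideanSpace ℝ (Fin 3) → ℝ, ∃ Cc : ℝ, MemLp Q 3 volume ∧
      eLpNorm Q 3 volume ≤ ENNReal.ofReal (Cq * (A * (-t) ^ (-(1 / 4 : ℝ))) ^ 2) ∧
      ∀ᵐ y ∂(volume : Measure (EuclideanSpace ℝ (Fin 3))), p₀ t y = Q y + Cc)
    {r : ℝ} (hr0 : 0 < r) (hrθ : r ≤ θ.rOut) (hr1 : 2 * r ^ 2 ≤ 1)
    {x : ℕ → EuclideanSpace ℝ (Fin 3)} (hx : ∀ n : ℕ, (n : ℝ) ≤ ‖x n‖) :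
    Tendsto (fun n => ∫⁻ z in Ioo (-(2 * r ^ 2)) 0 ×ˢ ball (x n) r,
      (‖u z.1 z.2‖ₑ ^ (3 : ℕ) + ‖p₀ z.1 z.2 - m (x n) z.1‖ₑ ^ (3 / 2 : ℝ))) atTop (𝓝 0) := by
  have hI1 : Ioo (-(2 * r ^ 2)) (0 : ℝ) ⊆ Ioo (-1 : ℝ) 0 := Ioo_subset_Ioo (by linarith) le_rfl
  -- the measurable slice functionals
  have hGm : ∀ n, Measurable (fun z : ℝ × EuclideanSpace ℝ (Fin 3) =>
      if z.1 < 0 then ‖u z.1 z.2‖ₑ ^ (3 : ℕ) + ‖p₀ z.1 z.2 - m (x n) z.1‖ₑ ^ (3 / 2 : ℝ) else 0) := by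
    intro n
    refine measurable_extendByZero_of_continuousOn ?_
    have hu' : ContinuousOn (fun z : ℝ × EuclideanSpace ℝ (Fin 3) => u z.1 z.2) (Iio 0 ×ˢ univ) :=
      hu.continuousOn_uncurry
    have hp' : ContinuousOn (fun z : ℝ × EuclideanSpace ℝ (Fin 3) => p₀ z.1 z.2) (Iio 0 ×ˢ univ) :=
      hsol₀.smooth_pressure.continuousOn
    have hm' : ContinuousOn (fun z : ℝ × EuclideanSpace ℝ (Fin 3) => m (x n) z.1) (Iio 0 ×ˢ univ) :=
      (hm_cont (x n)).comp continuousOn_fst fun z hz => (mem_prod.1 hz).1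
    exact (((ENNReal.continuous_pow 3).comp continuous_enorm).comp_continuousOn hu').add
      ((ENNReal.continuous_rpow_const.comp continuous_enorm).comp_continuousOn (hp'.sub hm'))
  set S : ℕ → ℝ → ℝ≥0∞ := fun n t => ∫⁻ y in ball (x n) r,
    (if ((t, y) : ℝ × EuclideanSpace ℝ (Fin 3)).1 < 0 then
      ‖u t y‖ₑ ^ (3 : ℕ) + ‖p₀ t y - m (x n) t‖ₑ ^ (3 / 2 : ℝ) else 0) with hS
  have hSm : ∀ n, Measurable (S n) := fun n => measurable_setLIntegral_slice (hGm n) _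
  have hSeq : ∀ n, ∀ t < (0 : ℝ), S n t =
      ∫⁻ y in ball (x n) r, (‖u t y‖ₑ ^ (3 : ℕ) + ‖p₀ t y - m (x n) t‖ₑ ^ (3 / 2 : ℝ)) := by
    intro n t ht
    simp only [hS, ht, if_true]
  -- the dominating function
  set K₀ : ℝ≥0∞ := (volume (ball (0 : EuclideanSpace ℝ (Fin 3)) r)) ^ (1 / 2 : ℝ) +
      (2 : ℝ≥0∞) ^ (1 / 2 : ℝ) * (ENNReal.ofReal (Cq ^ (3 / 2 : ℝ)) *
          (volume (ball (0 : EuclideanSpace ℝ (Fin 3)) r)) ^ (1 / 2 : ℝ) +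
        ENNReal.ofReal ((BΘ * (volume.real (closedBall (0 : EuclideanSpace ℝ (Fin 3)) θ.rOut)) ^
            (2 / 3 : ℝ) * Cq) ^ (3 / 2 : ℝ)) * volume (ball (0 : EuclideanSpace ℝ (Fin 3)) r)) with hK₀
  have hVtop : volume (ball (0 : EuclideanSpace ℝ (Fin 3)) r) ≠ ⊤ := measure_ball_lt_top.ne
  have hK₀top : K₀ ≠ ⊤ := by
    rw [hK₀]
    refine ENNReal.add_ne_top.2 ⟨ENNReal.rpow_ne_top_of_nonneg (by norm_num) hVtop,
      ENNReal.mul_ne_top (ENNReal.rpow_ne_top_of_nonneg (by norm_num) (by norm_num))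
        (ENNReal.add_ne_top.2 ⟨ENNReal.mul_ne_top ENNReal.ofReal_ne_top
          (ENNReal.rpow_ne_top_of_nonneg (by norm_num) hVtop),
          ENNReal.mul_ne_top ENNReal.ofReal_ne_top hVtop⟩)⟩
  set bound : ℝ → ℝ≥0∞ := fun t => ENNReal.ofReal (A ^ 3 * (-t) ^ (-(3 / 4 : ℝ))) * K₀ with hbound
  -- per slice: domination and decay
  have hslice : ∀ t ∈ Ioo (-(2 * r ^ 2)) (0 : ℝ),
      (∀ n, S n t ≤ bound t) ∧ Tendsto (fun n => S n t) atTop (𝓝 0) := by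
    intro t ht
    have ht1 := hI1 ht
    obtain ⟨Q, Cc, hQ, hQ3, hae⟩ := hdec t ht1
    have hℓ0 : 0 ≤ A * (-t) ^ (-(1 / 4 : ℝ)) := mul_nonneg hA (Real.rpow_nonneg (by linarith [ht.2]) _)
    have h := sliceFunctional_dominated_tendsto (mx := fun x₀ => m x₀ t) (x := x) (r := r)
      (hu.aestronglyMeasurable_slice ht.2) hQ hae hℓ0 hCq (h6 t ht1) hQ3 hBΘ
      (fun x₀ => hm_val x₀ t ht.2) hrθ hx
    rw [cube_mul_rpow_neg_quarter ht.2] at h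
    refine ⟨fun n => ?_, ?_⟩
    · rw [hSeq n t ht.2]; exact h.1 n
    · simp only [hSeq _ t ht.2]
      exact h.2
  -- the dominating function is integrable
  have hfin : ∫⁻ t in Ioo (-(2 * r ^ 2)) (0 : ℝ), bound t ≠ ⊤ := by
    have e : ∀ t, bound t = ENNReal.ofReal (A ^ 3) * K₀ * ENNReal.ofReal ((-t) ^ (-(3 / 4 : ℝ))) := by
      intro t
      rw [hbound]
      show ENNReal.ofReal (A ^ 3 * (-t) ^ (-(3 / 4 : ℝ))) * K₀ = _
      rw [ENNReal.ofReal_mul (by positivity)]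
      ring
    simp_rw [e]
    rw [lintegral_const_mul' _ _ (ENNReal.mul_ne_top ENNReal.ofReal_ne_top hK₀top),
      lintegral_Ioo_rpow_neg_threeQuarters (by positivity : (0 : ℝ) < 2 * r ^ 2)]
    exact ENNReal.mul_ne_top (ENNReal.mul_ne_top ENNReal.ofReal_ne_top hK₀top) ENNReal.ofReal_ne_top
  -- dominated convergence in time
  have hDCT : Tendsto (fun n => ∫⁻ t in Ioo (-(2 * r ^ 2)) (0 : ℝ), S n t) atTop (𝓝 0) := by
    have h := tendsto_lintegral_filter_of_dominated_convergence
      (μ := volume.restrict (Ioo (-(2 * r ^ 2)) (0 : ℝ))) (l := atTop) (F := S) (f := fun _ => 0) bound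
      (Eventually.of_forall hSm)
      (Eventually.of_forall fun n => (ae_restrict_iff' measurableSet_Ioo).2
        (ae_of_all _ fun t ht => (hslice t ht).1 n))
      hfin
      ((ae_restrict_iff' measurableSet_Ioo).2 (ae_of_all _ fun t ht => (hslice t ht).2))
    simpa using h
  -- Tonelli: the box integral is at most the iterated one
  refine tendsto_of_tendsto_of_tendsto_of_le_of_le tendsto_const_nhds hDCT (fun _ => zero_le)
    fun n => ?_
  refine (setLIntegral_prod_le_lintegral_lintegral _ _ _).trans (le_of_eq ?_)
  refine setLIntegral_congr_fun measurableSet_Ioo fun t ht => ?_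
  exact (hSeq n t ht.2).symm

/-! ### Step D2: far-field boundedness through the singular time -/

/-- **FAR-FIELD REGULARITY THROUGH THE SINGULAR TIME.** Every member `u` of a finite-dissipation
stratum `𝒟_{C,K}` is bounded near the final time outside a large ball: there are `R₀, M` with
`|u(t, x)| ≤ M` for all `t ∈ (−1/16, 0)` and `|x| ≥ R₀`. -/
theorem exists_farField_bound {C K : ℝ}
    {u : ℝ → EuclideanSpace ℝ (Fin 3) → EuclideanSpace ℝ (Fin 3)} (hu : IsTypeIAncientMild C u)
    (hlaw : ∀ s : ℝ, s < 0 → ∫⁻ x, ‖fderiv ℝ (u s) x‖ₑ ^ 2 ≤ ENNReal.ofReal (K / Real.sqrt (-s))) :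
    ∃ R₀ M : ℝ, ∀ t ∈ Ioo (-(1 / 16 : ℝ)) 0, ∀ x : EuclideanSpace ℝ (Fin 3),
      R₀ ≤ ‖x‖ → ‖u t x‖ ≤ M := by
  -- constants and the member's data
  obtain ⟨ε₀, C₀, hε₀, hC₀, Hε⟩ := exists_epsilon_apex
  obtain ⟨CL, hCL, hsix⟩ := exists_eLpNorm_six_rate_unif
  obtain ⟨Cq, hCq⟩ := exists_rieszPressure (show (1 : ℝ) < 6 / 2 by norm_num)
  obtain ⟨A, hA⟩ : ∃ A : ℝ, A = CL * Real.sqrt (max K 0) := ⟨_, rfl⟩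
  have hA0 : 0 ≤ A := by rw [hA]; positivity
  obtain ⟨p₀, hsol₀⟩ := exists_isClassicalNSSolutionOn_Iio hu
  have hLq : ∀ t ∈ Ioo (-1 : ℝ) 0, MemLp (u t) (ENNReal.ofReal 6) volume :=
    fun t ht => (hsix C K u hu hlaw t ht.2).1
  have hrate : ∀ t ∈ Ioo (-1 : ℝ) 0,
      eLpNorm (u t) (ENNReal.ofReal 6) volume ≤ ENNReal.ofReal (A * (-t) ^ (-(1 / 4 : ℝ))) := by
    intro t ht
    have h := (hsix C K u hu hlaw t ht.2).2
    rw [show (-((6 - 3) / (2 * 6) : ℝ)) = -(1 / 4 : ℝ) by norm_num] at h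
    rw [hA]; exact h
  have hdec0 := ChaeWolfEnergy.exists_rieszPressure_slice_of_rate_of_const (q := 6) (by norm_num) hCq
    hsol₀ (κ := 1 / 4) (K₀ := A) (T := 1) (by norm_num) hA0 hLq hrate
  have e3 : ENNReal.ofReal (6 / 2 : ℝ) = 3 := by norm_num
  have hdec : ∀ t ∈ Ioo (-1 : ℝ) 0, ∃ Q : EuclideanSpace ℝ (Fin 3) → ℝ, ∃ Cc : ℝ, MemLp Q 3 volume ∧
      eLpNorm Q 3 volume ≤ ENNReal.ofReal (Cq * (A * (-t) ^ (-(1 / 4 : ℝ))) ^ 2) ∧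
      ∀ᵐ y ∂(volume : Measure (EuclideanSpace ℝ (Fin 3))), p₀ t y = Q y + Cc := by
    intro t ht
    obtain ⟨Q, hQmem, hQle, -, Cc, hCc⟩ := hdec0 t ht
    have hℓ0 : 0 ≤ A * (-t) ^ (-(1 / 4 : ℝ)) := mul_nonneg hA0 (Real.rpow_nonneg (by linarith [ht.2]) _)
    rw [e3] at hQmem hQle
    refine ⟨Q, Cc, hQmem, hQle.trans ?_, hCc⟩
    rw [ENNReal.ofReal_mul Cq.coe_nonneg, ENNReal.ofReal_coe_nnreal, ENNReal.ofReal_pow hℓ0]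
    gcongr
    exact hrate t ht
  -- the bump of radius `1/2` and the local gauges
  let θ : ContDiffBump (0 : EuclideanSpace ℝ (Fin 3)) := ⟨1 / 4, 1 / 2, by norm_num, by norm_num⟩
  have hθ : θ.rOut = 1 / 2 := rfl
  obtain ⟨BΘ, hBΘdef⟩ : ∃ B : ℝ, B = 1 / (volume : Measure (EuclideanSpace ℝ (Fin 3))).real
      (closedBall (0 : EuclideanSpace ℝ (Fin 3)) θ.rIn) := ⟨_, rfl⟩
  have hBΘ : ∀ y, θ.normed volume y ≤ BΘ := fun y => by
    rw [hBΘdef]; exact θ.normed_le_div_measure_closedBall_rIn volume y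
  have hmex : ∀ x₀ : EuclideanSpace ℝ (Fin 3), ∃ mm : ℝ → ℝ, ContDiffOn ℝ (⊤ : ℕ∞) mm (Iio 0) ∧
      ∀ t ∈ Iio (0 : ℝ), mm t = ∫ y, θ.normed volume y * p₀ t (x₀ - y) :=
    fun x₀ => ChaeWolfEnergy.exists_smooth_normaliser hsol₀ isOpen_Iio x₀ θ
  choose m hm_smooth hm_val using hmex
  have hsol : ∀ x₀, IsClassicalNSSolutionOn (Iio 0) 1 0 u (fun t x => p₀ t x - m x₀ t) :=
    fun x₀ => isClassicalNSSolutionOn_sub_normaliser hsol₀ (hm_smooth x₀)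
  -- the CKN quantity with the local gauge is small far away
  have hclaim : ∃ R₀ : ℝ, ∀ x₀ : EuclideanSpace ℝ (Fin 3), R₀ ≤ ‖x₀‖ →
      ∫⁻ z in Ioo (-(2 * (1 / 2 : ℝ) ^ 2)) 0 ×ˢ ball x₀ (1 / 2),
        (‖u z.1 z.2‖ₑ ^ (3 : ℕ) + ‖(fun t x => p₀ t x - m x₀ t) z.1 z.2‖ₑ ^ (3 / 2 : ℝ)) ≤
        ENNReal.ofReal (ε₀ ^ 3 * (1 / 2 : ℝ) ^ 2) := by
    by_contra hcon
    push Not at hcon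
    choose x hxR hxJ using fun n : ℕ => hcon n
    have hlim := tendsto_cknQuantity_localGauge hu hsol₀ θ hBΘ (fun x₀ => (hm_smooth x₀).continuousOn)
      hm_val hA0 Cq.coe_nonneg hrate hdec (r := 1 / 2) (by norm_num) (by rw [hθ]) (by norm_num) hxR
    have hpos : (0 : ℝ≥0∞) < ENNReal.ofReal (ε₀ ^ 3 * (1 / 2 : ℝ) ^ 2) := ENNReal.ofReal_pos.2 (by positivity)
    obtain ⟨n, hn⟩ := ((tendsto_order.1 hlim).2 _ hpos).exists
    exact lt_asymm hn (hxJ n)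
  obtain ⟨R₀, hR₀⟩ := hclaim
  refine ⟨R₀, C₀ * ε₀ / (1 / 2), fun t ht x hx => ?_⟩
  have ht' : t ∈ Ioo (-((1 / 2 : ℝ) / 2) ^ 2) 0 := by
    refine ⟨?_, ht.2⟩
    have h1 : -(1 / 16 : ℝ) < t := ht.1
    norm_num
    linarith
  exact Hε u _ (hsol x) x (1 / 2) (by norm_num) (hR₀ x hx) t ht' x (mem_ball_self (by norm_num))

/-! ### Step D3: boundedness up to the singular time off the singular set -/

/-- **BLOW-UP IS CONFINED TO THE SINGULAR POINTS, uniformly up to the singular time and out to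
spatial infinity.** For a member `u` of a stratum `𝒟_{C,K}` and `δ > 0` there are `ρ > 0` and `M`
such that `|u(t, x)| ≤ M` for all `t ∈ (−ρ², 0)` and all `x` at distance `≥ δ` from every
final-time singular point of `u` (a point `s` is singular when `u` is unbounded on every
`(−ρ'², 0) × B(s, ρ')`). By `exists_finite_singularSet` the excluded set is a `δ`-neighbourhood of
at most `c (K⁺)³` points. (Far field: `exists_farField_bound`; near field: compactness and the
definition of a regular point.) -/
theorem exists_bound_off_singularSet {C K : ℝ}
    {u : ℝ → EuclideanSpace ℝ (Fin 3) → EuclideanSpace ℝ (Fin 3)} (hu : IsTypeIAncientMild C u)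
    (hlaw : ∀ s : ℝ, s < 0 → ∫⁻ x, ‖fderiv ℝ (u s) x‖ₑ ^ 2 ≤ ENNReal.ofReal (K / Real.sqrt (-s)))
    {δ : ℝ} (hδ : 0 < δ) :
    ∃ ρ M : ℝ, 0 < ρ ∧ ∀ t ∈ Ioo (-(ρ ^ 2)) (0 : ℝ), ∀ x : EuclideanSpace ℝ (Fin 3),
      (∀ s : EuclideanSpace ℝ (Fin 3),
        (∀ ρ' > 0, ∀ M' : ℝ, ∃ t' ∈ Ioo (-(ρ' ^ 2)) (0 : ℝ), ∃ y ∈ ball s ρ', M' < ‖u t' y‖) →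
          δ ≤ dist x s) →
      ‖u t x‖ ≤ M := by
  obtain ⟨R₀, M₁, hfar⟩ := exists_farField_bound hu hlaw
  -- the compact near region, `δ`-away from the singular points
  set F : Set (EuclideanSpace ℝ (Fin 3)) := closedBall 0 R₀ ∩ {x | ∀ s : EuclideanSpace ℝ (Fin 3),
      (∀ ρ' > 0, ∀ M' : ℝ, ∃ t' ∈ Ioo (-(ρ' ^ 2)) (0 : ℝ), ∃ y ∈ ball s ρ', M' < ‖u t' y‖) →
        δ ≤ dist x s} with hF
  have hFc : IsCompact F := by
    refine (isCompact_closedBall _ _).inter_right ?_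
    have e : {x : EuclideanSpace ℝ (Fin 3) | ∀ s : EuclideanSpace ℝ (Fin 3),
        (∀ ρ' > 0, ∀ M' : ℝ, ∃ t' ∈ Ioo (-(ρ' ^ 2)) (0 : ℝ), ∃ y ∈ ball s ρ', M' < ‖u t' y‖) →
          δ ≤ dist x s} = ⋂ (s : EuclideanSpace ℝ (Fin 3)) (_ :
        ∀ ρ' > 0, ∀ M' : ℝ, ∃ t' ∈ Ioo (-(ρ' ^ 2)) (0 : ℝ), ∃ y ∈ ball s ρ', M' < ‖u t' y‖),
          {x | δ ≤ dist x s} := by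
      ext x; simp only [mem_setOf_eq, mem_iInter]
    rw [e]
    exact isClosed_iInter fun s => isClosed_iInter fun _ =>
      isClosed_le continuous_const (continuous_id.dist continuous_const)
  -- near field: bounded on `(−ρ², 0) × F` for some `ρ > 0`
  have hnear : ∃ ρ : ℝ, 0 < ρ ∧ ∃ M₂ : ℝ, ∀ t ∈ Ioo (-(ρ ^ 2)) (0 : ℝ), ∀ x ∈ F, ‖u t x‖ ≤ M₂ := by
    by_contra hcon
    push Not at hcon
    have hseq : ∀ n : ℕ, ∃ t ∈ Ioo (-((1 / ((n : ℝ) + 1)) ^ 2)) (0 : ℝ), ∃ x ∈ F, (n : ℝ) < ‖u t x‖ :=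
      fun n => hcon _ (by positivity) n
    choose t ht x hxF hbig using hseq
    obtain ⟨a, haF, φ, hφ, hlim⟩ := hFc.tendsto_subseq hxF
    -- `a` is a regular point
    have hreg : ¬ (∀ ρ' > 0, ∀ M' : ℝ, ∃ t' ∈ Ioo (-(ρ' ^ 2)) (0 : ℝ), ∃ y ∈ ball a ρ', M' < ‖u t' y‖) := by
      intro hsing
      have h := haF.2 a hsing
      rw [dist_self] at h
      linarith
    push Not at hreg
    obtain ⟨ρa, hρa, Ma, hMa⟩ := hreg
    -- eventually the sequence enters the cylinder of `a`
    have h1 : ∀ᶠ n in atTop, x (φ n) ∈ ball a ρa :=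
      hlim (isOpen_ball.mem_nhds (mem_ball_self hρa))
    have h2 : ∀ᶠ n in atTop, ρa⁻¹ < (φ n : ℝ) + 1 := by
      have hφ' : Tendsto (fun n => (φ n : ℝ) + 1) atTop atTop :=
        tendsto_atTop_add_const_right _ _ (tendsto_natCast_atTop_atTop.comp hφ.tendsto_atTop)
      exact hφ'.eventually_gt_atTop _
    have h3 : ∀ᶠ n in atTop, Ma < (φ n : ℝ) :=
      (tendsto_natCast_atTop_atTop.comp hφ.tendsto_atTop).eventually_gt_atTop _
    obtain ⟨n, hn1, hn2, hn3⟩ := (h1.and (h2.and h3)).exists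
    have htn : t (φ n) ∈ Ioo (-(ρa ^ 2)) 0 := by
      refine ⟨lt_of_le_of_lt ?_ (ht (φ n)).1, (ht (φ n)).2⟩
      have hpos : (0 : ℝ) < (φ n : ℝ) + 1 := by positivity
      have h4 : 1 / ((φ n : ℝ) + 1) ≤ ρa := by
        rw [div_le_iff₀ hpos]
        have := (inv_lt_iff_one_lt_mul₀ hρa).1 hn2
        linarith
      have h5 : 0 ≤ 1 / ((φ n : ℝ) + 1) := by positivity
      nlinarith
    have := hMa _ htn _ hn1
    linarith [hbig (φ n)]
  obtain ⟨ρ₂, hρ₂, M₂, hM₂⟩ := hnear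
  refine ⟨min ρ₂ (1 / 4), max M₁ M₂, by positivity, fun t ht x hx => ?_⟩
  have hmin1 : min ρ₂ (1 / 4) ≤ ρ₂ := min_le_left _ _
  have hmin2 : min ρ₂ (1 / 4) ≤ 1 / 4 := min_le_right _ _
  have hmin0 : 0 < min ρ₂ (1 / 4) := by positivity
  by_cases hxR : R₀ ≤ ‖x‖
  · refine (hfar t ⟨?_, ht.2⟩ x hxR).trans (le_max_left _ _)
    have h1 : -(min ρ₂ (1 / 4)) ^ 2 < t := ht.1
    nlinarith
  · have hxF : x ∈ F := ⟨mem_closedBall_zero_iff.2 (not_le.1 hxR).le, hx⟩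
    refine (hM₂ t ⟨?_, ht.2⟩ x hxF).trans (le_max_right _ _)
    have h1 : -(min ρ₂ (1 / 4)) ^ 2 < t := ht.1
    nlinarith

/-! ### Step D4: the trace at the apex is a bounded function off the singular set -/

section Trace

open scoped RealInnerProductSpace

/-- **The distributional trace at the singular time is a bounded function away from the singular
points.** For a member `u` of a stratum `𝒟_{C,K}` and `δ > 0` there is `M` such that every limit
`L = lim_{t→0⁻} ∫ ⟪u(t), φ⟫` (the trace of lead g3, `exists_tendsto_pairing_finalSlice`) against a
test field `φ` supported at distance `≥ δ` from the final-time singular points obeys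
`|L| ≤ M ∫ ‖φ‖` — all the singular content of the (nonzero, for singular members) trace sits at the
finitely many singular points. -/
theorem trace_bounded_off_singularSet {C K : ℝ}
    {u : ℝ → EuclideanSpace ℝ (Fin 3) → EuclideanSpace ℝ (Fin 3)} (hu : IsTypeIAncientMild C u)
    (hlaw : ∀ s : ℝ, s < 0 → ∫⁻ x, ‖fderiv ℝ (u s) x‖ₑ ^ 2 ≤ ENNReal.ofReal (K / Real.sqrt (-s)))
    {δ : ℝ} (hδ : 0 < δ) :
    ∃ M : ℝ, ∀ (φ : EuclideanSpace ℝ (Fin 3) → EuclideanSpace ℝ (Fin 3)),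
      FunctionSpaces.IsTestFunctionOn (⊤ : Opens (EuclideanSpace ℝ (Fin 3))) φ →
      (∀ x, φ x ≠ 0 → ∀ s : EuclideanSpace ℝ (Fin 3),
        (∀ ρ' > 0, ∀ M' : ℝ, ∃ t' ∈ Ioo (-(ρ' ^ 2)) (0 : ℝ), ∃ y ∈ ball s ρ', M' < ‖u t' y‖) →
          δ ≤ dist x s) →
      ∀ L : ℝ, Tendsto (fun t => ∫ x, ⟪u t x, φ x⟫) (𝓝[<] 0) (𝓝 L) → |L| ≤ M * ∫ x, ‖φ x‖ := by
  obtain ⟨ρ, M, hρ, hM⟩ := exists_bound_off_singularSet hu hlaw hδ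
  refine ⟨max M 0, fun φ hφ hsupp L hL => ?_⟩
  have hφc : Continuous φ := hφ.contDiff.continuous
  have hφcs : HasCompactSupport φ := hφ.hasCompactSupport
  -- the pairing is eventually bounded by `max M 0 · ∫ ‖φ‖`
  have hev : ∀ᶠ t in 𝓝[<] (0 : ℝ), |∫ x, ⟪u t x, φ x⟫| ≤ max M 0 * ∫ x, ‖φ x‖ := by
    filter_upwards [Ioo_mem_nhdsLT (show -(ρ ^ 2) < (0 : ℝ) by nlinarith)] with t ht
    have hpt : ∀ x, ‖⟪u t x, φ x⟫‖ ≤ max M 0 * ‖φ x‖ := by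
      intro x
      by_cases hx : φ x = 0
      · simp [hx]
      · calc ‖⟪u t x, φ x⟫‖ ≤ ‖u t x‖ * ‖φ x‖ := norm_inner_le_norm _ _
          _ ≤ max M 0 * ‖φ x‖ := by
              gcongr
              exact (hM t ht x (hsupp x hx)).trans (le_max_left _ _)
    rw [← Real.norm_eq_abs]
    calc ‖∫ x, ⟪u t x, φ x⟫‖ ≤ ∫ x, max M 0 * ‖φ x‖ :=
          norm_integral_le_of_norm_le ((hφc.norm.integrable_of_hasCompactSupport hφcs.norm).const_mul _)
            (Eventually.of_forall hpt)
      _ = max M 0 * ∫ x, ‖φ x‖ := integral_const_mul _ _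
  have habs : Tendsto (fun t => |∫ x, ⟪u t x, φ x⟫|) (𝓝[<] 0) (𝓝 |L|) :=
    (continuous_abs.tendsto L).comp hL
  exact le_of_tendsto habs hev

end Trace

end Summit.NavierStokesRegularity.NavierStokesRegularity.Theorems.FiniteDissipationLiouville.Birth.Apex

end
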